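import Summits.QuantumFields.BalabanUV.T4Continuum.Support.SmoothRefineBlocks
import HarnessLib

/-!
# T⁴ programme, node NE3 — the kinematic refinement lemma, abelian line, file 3: MULTILINEAR INTERPOLATION OF A COARSE
# FUNCTION ON THE BLOCKS OF THE FINE LATTICE (`SmoothRefineInterp`)

Cell `pub-balaban`, NE3 formalisation swarm (`t4/formal/NE3/LEAVES.md` row S4b, unit
`b2b-balaban-t4-ne3-formalise-leaf-10`); sequel of `SmoothRefineBlocks`.  PURE LATTICE CALCULUS with values in a real
vector space `X` (nothing about gauge fields): for a set `S` of coordinate directions, the fine-lattice function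
`interp L S G y = Σ_{T ⊆ S} (Π_{λ∈T} ρ_λ/L)(Π_{λ∈S∖T} (1 − ρ_λ/L)) • G(⌊y/L⌋ + 1_T)` — the coarse function `G` interpolated
MULTILINEARLY in the directions of `S` inside each block (`ρ = res L y` the offset) and read piecewise-constantly in the
others.  This is the coordinatewise tensor product of the two refinement maps of a function on `ℤ` to `(1/L)ℤ` — linear
interpolation (`λ ∈ S`) and left-endpoint extension (`λ ∉ S`) — from which the cubical Whitney refinement of cochains and its
homotopy to the corner pullback are built in the sequel `SmoothRefineWhitney`.

§1 the vertex vector `indic T = Σ_{λ∈T} e_λ` and the algebraic core `interpCore S G z w` (weights `w`), its recursion in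
`S` (`interpCore_insert`: `I_{S ∪ {λ}} G = (1 − w_λ) • I_S G + w_λ • I_S G(· + e_λ)`), linearity and constancy;
§2 CONVEXITY: a bound `‖G‖ ≤ M` at the `2^{|S|}` vertices bounds `‖interpCore S G z w‖ ≤ M` (`0 ≤ w ≤ 1`), and the centred
form `‖interpCore S G z w − G z‖ ≤ |S|·δ` from a bound `δ` on the coarse differences of `G`;
§3 on the fine lattice (`w_λ = ρ_λ/L`): `interp_empty`, the value at offsets `ρ|_S = 0`, and THE DIFFERENCE FORMULA
`interp S G (y + e_α) − interp S G y = a_S(α, ρ_α) • interp (S ∖ {α}) (∇_α G) y` with `a_S(α, t) = 1/L` for `α ∈ S` and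
`[t = L − 1]` for `α ∉ S` — one formula for the in-block steps and the block-crossing step (piecewise-linear functions are
continuous), the engine of every identity and estimate of the Whitney refinement.

HONEST FRAMING: finite-`T⁴` lattice calculus for the kinematics of block averaging (rung (B)+1 — NOT infinite volume, NOT
a mass gap, NOT Clay); no estimate of the programme, nothing of NE3 claimed; no `BetaPertH`, no (B), no G-an2-4; no
printed sentence is a hypothesis.  PLACEMENT (human rule 2026-08-19): our work, under `Summits/QuantumFields/BalabanUV/`.
-/

set_option autoImplicit false

open scoped BigOperators

namespace Summit.QuantumFields.BalabanUV.T4Continuum.SmoothRefineInterp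

open Literature.MathematicalPhysics.QuantumFieldTheory.Balaban1983to89
open B7Prop1Explicit SmoothRefineBlocks

noncomputable section

variable {d : ℕ}


/-! ## §1 The vertex vector and the algebraic core -/

/-- The `0/1`-vector of a set of directions: `indic T = Σ_{λ ∈ T} e_λ`. [folklore] -/
def indic (T : Finset (Fin d)) : Site d := ∑ i ∈ T, e i

/-- `indic ∅ = 0`. [folklore] -/
@[simp] theorem indic_empty : indic (∅ : Finset (Fin d)) = 0 := by simp [indic]

/-- `indic (insert λ T) = e_λ + indic T` for `λ ∉ T`. [folklore] -/
theorem indic_insert {T : Finset (Fin d)} {i : Fin d} (h : i ∉ T) : indic (insert i T) = e i + indic T := by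
  simp [indic, Finset.sum_insert h]

/-- The coordinates of `indic T`: `1` on `T`, `0` off `T`. [folklore] -/
theorem indic_apply (T : Finset (Fin d)) (j : Fin d) : indic T j = if j ∈ T then 1 else 0 := by
  simp only [indic, Finset.sum_apply, e_apply, Finset.sum_ite_eq]

/-- The coarse forward difference in direction `α`: `(∇_α G)(z) = G(z + e_α) − G(z)`. [folklore] -/
def cfd {X : Type*} [AddCommGroup X] (α : Fin d) (G : Site d → X) : Site d → X := fun z => G (z + e α) - G z

section Core

variable {X : Type*} [AddCommGroup X] [Module ℝ X]

/-- THE ALGEBRAIC CORE of multilinear interpolation: with weights `w`,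
`interpCore S G z w = Σ_{T ⊆ S} (Π_{λ∈T} w_λ)(Π_{λ∈S∖T}(1 − w_λ)) • G(z + indic T)`. [folklore] -/
def interpCore (S : Finset (Fin d)) (G : Site d → X) (z : Site d) (w : Fin d → ℝ) : X :=
  ∑ T ∈ S.powerset, ((∏ i ∈ T, w i) * ∏ i ∈ S \ T, (1 - w i)) • G (z + indic T)

/-- No interpolated direction: the value at the base point. [folklore] -/
@[simp] theorem interpCore_empty (G : Site d → X) (z : Site d) (w : Fin d → ℝ) : interpCore ∅ G z w = G z := by
  simp [interpCore]

/-- RECURSION IN THE SET OF DIRECTIONS: `I_{S ∪ {λ}} G = (1 − w_λ) • I_S G + w_λ • I_S (G(· + e_λ))`. [folklore] -/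
theorem interpCore_insert {S : Finset (Fin d)} {i : Fin d} (hi : i ∉ S) (G : Site d → X) (z : Site d)
    (w : Fin d → ℝ) :
    interpCore (insert i S) G z w =
      (1 - w i) • interpCore S G z w + w i • interpCore S (fun x => G (x + e i)) z w := by
  unfold interpCore
  rw [Finset.sum_powerset_insert hi, Finset.smul_sum, Finset.smul_sum]
  congr 1
  · refine Finset.sum_congr rfl fun T hT => ?_
    rw [Finset.mem_powerset] at hT
    have hiT : i ∉ T := fun h => hi (hT h)
    rw [Finset.insert_sdiff_of_notMem S hiT, Finset.prod_insert (fun h => hi (Finset.mem_sdiff.1 h).1), smul_smul]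
    congr 1; ring
  · refine Finset.sum_congr rfl fun T hT => ?_
    rw [Finset.mem_powerset] at hT
    have hiT : i ∉ T := fun h => hi (hT h)
    rw [Finset.prod_insert hiT, Finset.insert_sdiff_insert, Finset.sdiff_insert_of_notMem hi, indic_insert hiT,
      smul_smul, show z + (e i + indic T) = z + indic T + e i by abel]
    congr 1; ring

/-- Linearity in `G`: subtraction. [folklore] -/
theorem interpCore_sub (S : Finset (Fin d)) (G G' : Site d → X) (z : Site d) (w : Fin d → ℝ) :
    interpCore S (fun x => G x - G' x) z w = interpCore S G z w - interpCore S G' z w := by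
  simp only [interpCore, smul_sub, Finset.sum_sub_distrib]

/-- Linearity in `G`: addition. [folklore] -/
theorem interpCore_add (S : Finset (Fin d)) (G G' : Site d → X) (z : Site d) (w : Fin d → ℝ) :
    interpCore S (fun x => G x + G' x) z w = interpCore S G z w + interpCore S G' z w := by
  simp only [interpCore, smul_add, Finset.sum_add_distrib]

/-- Linearity in `G`: scalars. [folklore] -/
theorem interpCore_smul (S : Finset (Fin d)) (c : ℝ) (G : Site d → X) (z : Site d) (w : Fin d → ℝ) :
    interpCore S (fun x => c • G x) z w = c • interpCore S G z w := by
  simp only [interpCore, smul_comm c, Finset.smul_sum]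

/-- The weights sum to one: a constant is reproduced. [folklore] -/
theorem interpCore_const (S : Finset (Fin d)) (C : X) (z : Site d) (w : Fin d → ℝ) :
    interpCore S (fun _ => C) z w = C := by
  induction S using Finset.induction_on with
  | empty => simp
  | insert i S hi ih =>
    rw [interpCore_insert hi]
    simp only [ih]
    rw [← add_smul]; simp

/-- Shifting the base point is shifting the function. [folklore] -/
theorem interpCore_shift (S : Finset (Fin d)) (G : Site d → X) (z v : Site d) (w : Fin d → ℝ) :
    interpCore S G (z + v) w = interpCore S (fun x => G (x + v)) z w := by
  unfold interpCore
  refine Finset.sum_congr rfl fun T _ => ?_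
  rw [add_right_comm]

/-- The core depends on the weights only through their values on `S`. [folklore] -/
theorem interpCore_congr_weights (S : Finset (Fin d)) (G : Site d → X) (z : Site d) {w w' : Fin d → ℝ}
    (h : ∀ i ∈ S, w i = w' i) : interpCore S G z w = interpCore S G z w' := by
  unfold interpCore
  refine Finset.sum_congr rfl fun T hT => ?_
  rw [Finset.mem_powerset] at hT
  have h1 : ∏ i ∈ T, w i = ∏ i ∈ T, w' i := Finset.prod_congr rfl fun i hi => h i (hT hi)
  have h2 : ∏ i ∈ S \ T, (1 - w i) = ∏ i ∈ S \ T, (1 - w' i) :=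
    Finset.prod_congr rfl fun i hi => by rw [h i (Finset.mem_sdiff.1 hi).1]
  rw [h1, h2]

/-- MEMBERSHIP: if all values of `G` lie in an additive subgroup `K` stable under the real scalars, so does the
interpolation (it is a real linear combination of values of `G`). [folklore] -/
theorem interpCore_mem (K : AddSubgroup X) (hK : ∀ (r : ℝ) (x : X), x ∈ K → r • x ∈ K) (S : Finset (Fin d))
    {G : Site d → X} (hG : ∀ x, G x ∈ K) (z : Site d) (w : Fin d → ℝ) : interpCore S G z w ∈ K := by
  unfold interpCore
  exact Finset.sum_induction _ (fun x => x ∈ K) (fun a b ha hb => K.add_mem ha hb) K.zero_mem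
    (fun T _ => hK _ _ (hG _))

end Core

/-! ## §2 Convexity bounds -/

section Bounds

variable {X : Type*} [NormedAddCommGroup X] [NormedSpace ℝ X]

/-- CONVEXITY: weights in `[0,1]` and a bound `M` on `G` at all shifted base points give `‖interpCore S G z w‖ ≤ M`.
(Stated with the bound on ALL of `G`'s values, which is what the sequel has.) [folklore] -/
theorem norm_interpCore_le (S : Finset (Fin d)) {w : Fin d → ℝ} (hw0 : ∀ i, 0 ≤ w i) (hw1 : ∀ i, w i ≤ 1) {M : ℝ}
    (G : Site d → X) (hG : ∀ x, ‖G x‖ ≤ M) (z : Site d) : ‖interpCore S G z w‖ ≤ M := by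
  induction S using Finset.induction_on generalizing G with
  | empty => simpa using hG z
  | insert i S hi ih =>
    rw [interpCore_insert hi]
    have h1 := ih G hG
    have h2 := ih (fun x => G (x + e i)) fun x => hG _
    calc ‖(1 - w i) • interpCore S G z w + w i • interpCore S (fun x => G (x + e i)) z w‖
        ≤ ‖(1 - w i) • interpCore S G z w‖ + ‖w i • interpCore S (fun x => G (x + e i)) z w‖ := norm_add_le _ _
      _ ≤ (1 - w i) * M + w i * M := by
          rw [norm_smul, norm_smul, Real.norm_of_nonneg (hw0 i), Real.norm_of_nonneg (by linarith [hw1 i])]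
          exact add_le_add (mul_le_mul_of_nonneg_left h1 (by linarith [hw1 i]))
            (mul_le_mul_of_nonneg_left h2 (hw0 i))
      _ = M := by ring

omit [NormedSpace ℝ X] in
/-- A bound `δ` on all coarse differences bounds the variation over a vertex vector: `‖G(z + indic T) − G z‖ ≤ |T|·δ`.
[folklore] -/
theorem norm_sub_indic_le (G : Site d → X) {δ : ℝ} (hδ : ∀ (x : Site d) (α : Fin d), ‖G (x + e α) - G x‖ ≤ δ)
    (z : Site d) (T : Finset (Fin d)) : ‖G (z + indic T) - G z‖ ≤ T.card * δ := by
  induction T using Finset.induction_on with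
  | empty => simp
  | insert i T hi ih =>
    rw [indic_insert hi, Finset.card_insert_of_notMem hi, Nat.cast_succ, add_mul, one_mul,
      show z + (e i + indic T) = z + indic T + e i by abel]
    calc ‖G (z + indic T + e i) - G z‖
        = ‖(G (z + indic T + e i) - G (z + indic T)) + (G (z + indic T) - G z)‖ := by rw [sub_add_sub_cancel]
      _ ≤ ‖G (z + indic T + e i) - G (z + indic T)‖ + ‖G (z + indic T) - G z‖ := norm_add_le _ _
      _ ≤ δ + T.card * δ := add_le_add (hδ _ _) ih
      _ = T.card * δ + δ := by ring

/-- CENTRED CONVEXITY: `‖interpCore S G z w − G z‖ ≤ |S|·δ` from a bound `δ` on the coarse differences of `G`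
(weights in `[0,1]`). [folklore] -/
theorem norm_interpCore_sub_le (S : Finset (Fin d)) {w : Fin d → ℝ} (hw0 : ∀ i, 0 ≤ w i) (hw1 : ∀ i, w i ≤ 1)
    (G : Site d → X) {δ : ℝ} (hδ0 : 0 ≤ δ) (hδ : ∀ (x : Site d) (α : Fin d), ‖G (x + e α) - G x‖ ≤ δ) (z : Site d) :
    ‖interpCore S G z w - G z‖ ≤ S.card * δ := by
  -- interpolate the centred function `x ↦ G x − G z`, bounded by `|S|·δ` at the relevant vertices
  have key : ∀ (S' : Finset (Fin d)), S' ⊆ S → ∀ (v : Finset (Fin d)), v ⊆ S → Disjoint v S' →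
      ‖interpCore S' (fun x => G (x + indic v) - G z) z w‖ ≤ (v.card + S'.card) * δ := by
    intro S'
    induction S' using Finset.induction_on with
    | empty =>
      intro _ v hv _
      simp only [interpCore_empty, Finset.card_empty, Nat.cast_zero, add_zero]
      exact norm_sub_indic_le G hδ z v
    | insert i S' hi ih =>
      intro hS v hv hdisj
      have hiS : i ∈ S := hS (Finset.mem_insert_self i S')
      have hS'S : S' ⊆ S := fun j hj => hS (Finset.mem_insert_of_mem hj)
      have hiv : i ∉ v := fun h => Finset.disjoint_left.1 hdisj h (Finset.mem_insert_self i S')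
      have hdisj' : Disjoint v S' := Finset.disjoint_of_subset_right (Finset.subset_insert i S') hdisj
      rw [interpCore_insert hi, Finset.card_insert_of_notMem hi]
      have h1 := ih hS'S v hv hdisj'
      have h2 : ‖interpCore S' (fun x => G (x + e i + indic v) - G z) z w‖ ≤ ((insert i v).card + S'.card) * δ := by
        have := ih hS'S (insert i v) (Finset.insert_subset hiS hv)
          (Finset.disjoint_insert_left.2 ⟨hi, hdisj'⟩)
        simpa only [indic_insert hiv, show ∀ x : Site d, x + (e i + indic v) = x + e i + indic v from fun x => by abel]
          using this
      rw [Finset.card_insert_of_notMem hiv] at h2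
      set A : ℝ := (v.card : ℝ) + S'.card with hA
      have h2' : ‖interpCore S' (fun x => G (x + e i + indic v) - G z) z w‖ ≤ (A + 1) * δ := by
        refine h2.trans (le_of_eq ?_)
        rw [hA]; push_cast; ring
      have hw := hw1 i
      have hw' := hw0 i
      calc ‖(1 - w i) • interpCore S' (fun x => G (x + indic v) - G z) z w
            + w i • interpCore S' (fun x => G (x + e i + indic v) - G z) z w‖
          ≤ (1 - w i) * (A * δ) + w i * ((A + 1) * δ) := by
            refine (norm_add_le _ _).trans (add_le_add ?_ ?_)
            · rw [norm_smul, Real.norm_of_nonneg (by linarith)]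
              exact mul_le_mul_of_nonneg_left h1 (by linarith)
            · rw [norm_smul, Real.norm_of_nonneg hw']
              exact mul_le_mul_of_nonneg_left h2' hw'
        _ = (A + w i) * δ := by ring
        _ ≤ (A + 1) * δ := by nlinarith
        _ = ((v.card : ℝ) + ((S'.card + 1 : ℕ) : ℝ)) * δ := by rw [hA]; push_cast; ring
  have h := key S le_rfl ∅ (Finset.empty_subset _) (Finset.disjoint_empty_left _)
  simp only [indic_empty, add_zero, Finset.card_empty, Nat.cast_zero, zero_add] at h
  rwa [interpCore_sub, interpCore_const] at h

end Bounds

/-! ## §3 On the fine lattice -/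

section Fine

variable {X : Type*} [AddCommGroup X] [Module ℝ X]

/-- The interpolation weights of a fine site: `ρ_λ / L`. [folklore] -/
def wt (L : ℕ) (y : Site d) : Fin d → ℝ := fun i => (res L y i : ℝ) / L

/-- `0 ≤ ρ_λ/L`. [folklore] -/
theorem wt_nonneg {L : ℕ} (hL : 1 ≤ L) (y : Site d) (i : Fin d) : 0 ≤ wt L y i :=
  div_nonneg (by exact_mod_cast res_nonneg hL y i) (by positivity)

/-- `ρ_λ/L ≤ 1`. [folklore] -/
theorem wt_le_one {L : ℕ} (hL : 1 ≤ L) (y : Site d) (i : Fin d) : wt L y i ≤ 1 := by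
  have hL0 : (0 : ℝ) < L := by exact_mod_cast (by omega : 0 < L)
  rw [wt, div_le_one hL0]
  exact_mod_cast (res_lt hL y i).le

/-- MULTILINEAR INTERPOLATION of the coarse function `G` in the directions `S`, read at the fine site `y`. [folklore] -/
def interp (L : ℕ) (S : Finset (Fin d)) (G : Site d → X) (y : Site d) : X := interpCore S G (blk L y) (wt L y)

/-- No interpolated direction: the block value. [folklore] -/
@[simp] theorem interp_empty (L : ℕ) (G : Site d → X) (y : Site d) : interp L ∅ G y = G (blk L y) := by
  simp [interp]

/-- At offsets vanishing on `S` the interpolation returns the block value. [folklore] -/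
theorem interp_of_res_eq_zero (L : ℕ) (S : Finset (Fin d)) (G : Site d → X) (y : Site d)
    (h : ∀ i ∈ S, res L y i = 0) : interp L S G y = G (blk L y) := by
  unfold interp
  rw [interpCore_congr_weights S G (blk L y) (w' := fun _ => 0) (fun i hi => by simp [wt, h i hi])]
  induction S using Finset.induction_on with
  | empty => simp
  | insert i S hi ih =>
    rw [interpCore_insert hi, ih (fun j hj => h j (Finset.mem_insert_of_mem hj))]
    simp

/-- Linearity: subtraction. [folklore] -/
theorem interp_sub (L : ℕ) (S : Finset (Fin d)) (G G' : Site d → X) (y : Site d) :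
    interp L S (fun x => G x - G' x) y = interp L S G y - interp L S G' y := interpCore_sub _ _ _ _ _

/-- Linearity: scalars. [folklore] -/
theorem interp_smul (L : ℕ) (S : Finset (Fin d)) (c : ℝ) (G : Site d → X) (y : Site d) :
    interp L S (fun x => c • G x) y = c • interp L S G y := interpCore_smul _ _ _ _ _

/-- Recursion in the set of directions on the fine lattice. [folklore] -/
theorem interp_insert (L : ℕ) {S : Finset (Fin d)} {i : Fin d} (hi : i ∉ S) (G : Site d → X) (y : Site d) :
    interp L (insert i S) G y =
      (1 - wt L y i) • interp L S G y + wt L y i • interp L S (fun x => G (x + e i)) y :=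
  interpCore_insert hi G _ _

/-- The coefficient of the difference formula: `1/L` in an interpolated direction, the indicator of the last slice in a
piecewise-constant one. [folklore] -/
def dcoef (L : ℕ) (S : Finset (Fin d)) (y : Site d) (α : Fin d) : ℝ :=
  if α ∈ S then 1 / (L : ℝ) else if res L y α = (L : ℤ) - 1 then 1 else 0

/-- A unit step in a direction OUTSIDE `S`: nothing changes inside the block, and the block value shifts by `e_α` at the
crossing. [folklore] -/
theorem interp_add_e_of_notMem {L : ℕ} (hL : 1 ≤ L) {S : Finset (Fin d)} {α : Fin d} (hα : α ∉ S) (G : Site d → X)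
    (y : Site d) :
    interp L S G (y + e α) = if res L y α = (L : ℤ) - 1 then interp L S (fun x => G (x + e α)) y else interp L S G y := by
  unfold interp
  have hw : ∀ i ∈ S, wt L (y + e α) i = wt L y i := fun i hi => by
    have : i ≠ α := fun h => hα (h ▸ hi)
    simp [wt, res_add_e_ne hL y this]
  rw [interpCore_congr_weights S G _ hw, blk_add_e hL]
  split_ifs with h
  · rw [interpCore_shift]
  · rw [add_zero]

/-- A unit step in a direction INSIDE `S`. [folklore] -/
theorem interp_add_e_of_mem {L : ℕ} (hL : 1 ≤ L) {S : Finset (Fin d)} {α : Fin d} (hα : α ∈ S) (G : Site d → X)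
    (y : Site d) :
    interp L S G (y + e α) - interp L S G y = (1 / (L : ℝ)) • interp L (S.erase α) (cfd α G) y := by
  have hL0 : (L : ℝ) ≠ 0 := by exact_mod_cast (by omega : L ≠ 0)
  set S' := S.erase α with hS'
  have hαS' : α ∉ S' := Finset.notMem_erase α S
  have hS : S = insert α S' := (Finset.insert_erase hα).symm
  rw [hS, interp_insert L hαS', interp_insert L hαS']
  -- the `S'`-interpolants do not see the `α`-offset; at the crossing the block shifts
  have hstep := interp_add_e_of_notMem hL hαS' G y
  have hstep' := interp_add_e_of_notMem hL hαS' (fun x => G (x + e α)) y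
  have hwt : wt L (y + e α) α = if res L y α = (L : ℤ) - 1 then 0 else wt L y α + 1 / (L : ℝ) := by
    simp only [wt, res_add_e_self hL]
    split_ifs <;> simp [add_div]
  unfold cfd
  rw [interp_sub]
  by_cases h : res L y α = (L : ℤ) - 1
  · simp only [h, ↓reduceIte] at hstep hstep' hwt
    rw [hstep, hstep', hwt]
    have hw1 : wt L y α = 1 - 1 / (L : ℝ) := by
      simp only [wt, h]; push_cast; field_simp
    rw [hw1]
    module
  · simp only [h, ↓reduceIte] at hstep hstep' hwt
    rw [hstep, hstep', hwt]
    module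

/-- **THE DIFFERENCE FORMULA**: `interp S G (y + e_α) − interp S G y = a_S(α, ρ_α) • interp (S ∖ {α}) (∇_α G) y`, with
`a_S(α,·) = 1/L` for `α ∈ S` and the last-slice indicator for `α ∉ S`. [folklore] -/
theorem interp_fd {L : ℕ} (hL : 1 ≤ L) (S : Finset (Fin d)) (α : Fin d) (G : Site d → X) (y : Site d) :
    interp L S G (y + e α) - interp L S G y = dcoef L S y α • interp L (S.erase α) (cfd α G) y := by
  unfold dcoef
  by_cases hα : α ∈ S
  · rw [if_pos hα, interp_add_e_of_mem hL hα]
  · rw [if_neg hα, Finset.erase_eq_of_notMem hα, interp_add_e_of_notMem hL hα]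
    split_ifs with h
    · unfold cfd; rw [interp_sub, one_smul]
    · rw [sub_self, zero_smul]

/-- MEMBERSHIP of the interpolation in a real-stable additive subgroup. [folklore] -/
theorem interp_mem (K : AddSubgroup X) (hK : ∀ (r : ℝ) (x : X), x ∈ K → r • x ∈ K) (L : ℕ) (S : Finset (Fin d))
    {G : Site d → X} (hG : ∀ x, G x ∈ K) (y : Site d) : interp L S G y ∈ K :=
  interpCore_mem K hK S hG _ _

end Fine

section FineBounds

variable {X : Type*} [NormedAddCommGroup X] [NormedSpace ℝ X]

/-- `‖interp L S G y‖ ≤ M` from `‖G‖ ≤ M`. [folklore] -/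
theorem norm_interp_le {L : ℕ} (hL : 1 ≤ L) (S : Finset (Fin d)) (G : Site d → X) {M : ℝ} (hG : ∀ x, ‖G x‖ ≤ M)
    (y : Site d) : ‖interp L S G y‖ ≤ M :=
  norm_interpCore_le S (wt_nonneg hL y) (wt_le_one hL y) G hG _

/-- `‖interp L S G y − G ⌊y/L⌋‖ ≤ |S|·δ` from a bound `δ` on the coarse differences of `G`. [folklore] -/
theorem norm_interp_sub_blk_le {L : ℕ} (hL : 1 ≤ L) (S : Finset (Fin d)) (G : Site d → X) {δ : ℝ} (hδ0 : 0 ≤ δ)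
    (hδ : ∀ (x : Site d) (α : Fin d), ‖G (x + e α) - G x‖ ≤ δ) (y : Site d) :
    ‖interp L S G y - G (blk L y)‖ ≤ S.card * δ :=
  norm_interpCore_sub_le S (wt_nonneg hL y) (wt_le_one hL y) G hδ0 hδ _

/-- `|a_S(α, ρ_α)| ≤ 1`. [folklore] -/
theorem abs_dcoef_le_one {L : ℕ} (hL : 1 ≤ L) (S : Finset (Fin d)) (y : Site d) (α : Fin d) :
    |dcoef L S y α| ≤ 1 := by
  unfold dcoef
  have hL1 : (1 : ℝ) ≤ L := by exact_mod_cast hL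
  split_ifs
  · rw [abs_of_nonneg (by positivity)]
    exact (div_le_one (by linarith)).2 hL1
  · simp
  · simp

/-- `0 ≤ a_S(α, ρ_α)`. [folklore] -/
theorem dcoef_nonneg (L : ℕ) (S : Finset (Fin d)) (y : Site d) (α : Fin d) : 0 ≤ dcoef L S y α := by
  unfold dcoef
  split_ifs <;> positivity

end FineBounds

end

end Summit.QuantumFields.BalabanUV.T4Continuum.SmoothRefineInterp
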